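import Summits.ABC.IUTFork.LDHTensorStepV
import Literature.IUT.LogVolume.TensorPacketStepVWith
import HarnessLib

/-!
# The fork at [IUTchIII] Corollary 3.12, L-DH level: D9′ per summand and `EstimateDH` for Dupuy–Hilado data over
# the real tensor-packet model in MOCHIZUKI's shell normalisation, from the IDELES ALONE (`DHData.ofIdelesM`)

Record-only file (D-0012) of the abc-iut cell (WAVE-3 discharge seat abc-iut-c312-d1; plan/D9PRIME-OBLIGATIONS.md
row O2, planner ruling R6 2026-08-25T22:47Z "main line = sharp-as-hypothesis"); TAKES NO SIDE. Sequel to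
`LDHTensorStepV.lean` for abc-iut-c312-3's `realPrimePacketWith` / `realPrimePacketM` / `DHData.ofIdelesM`
(`TensorPacketModelScaled.lean`, `LDHTensor.lean`): with Mochizuki's container `p^{−⌈d_I+a_I⌉}·log_p(R_I^×)` as the
shell the MINIMAL (Ind3)-datum `O_𝕃(−P_Θ)` exists (c312-3 `minimalDHDatumM`), so the SHARP reading is REALISED
and the per-summand Step (v) bound, `EstimateDH` with the explicit constant of `LDHTensorStepV`, and the squeeze
`Cor312DH → deĝ̲_lgp(P_Θ) − deĝ̲(P_q) ≤ δΣ` hold for `DHData.ofIdelesM X 𝔽 tΘ … T …` with NO hypothesis beyond the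
ideles ([IUTchIV] Prop. 1.2 (ii) by abc-iut-S6's `prop12ii_holds`; sharpness by construction,
`ofIdelesM_bare3_subset_region`). With Dupuy–Hilado's own normalisation no datum exists at wildly ramified tuples
(HOME/plan/c312/R7C3Q1-COMPUTATION.md), which is why the idele-built model is the inhabited main line.
Mochizuki, *IUT IV*, proof of Thm. 1.10, Steps (iv)–(viii) pp. 26–30. [cite: Mochizuki2012, IUTchIV Thm 1.10
proof Step (v) p.27–28] [cite: DupuyHilado2025, §3.9, §4.7–4.12] [claim: Mochizuki2012, status: disputed]
HONEST SCOPE: `Cor312DH` stays a hypothesis; nothing asserts it or takes a side on Cor. 3.12.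
-/

noncomputable section

open Set NumberField IsDedekindDomain
open scoped Pointwise

namespace Literature.IUT.LogVolume

variable {F : Type} [Field F] [NumberField F]

section RealWith

variable {p : ℕ} [Fact p.Prime] (𝔽 : LocalFields F p)
variable (c : (j : ℕ) → (Fin (j + 1) → placesOver F p) → ℚ_[p]) (hc0 : ∀ j e, c j e ≠ 0)
  (hcσ : ∀ (j : ℕ) (σ : Equiv.Perm (Fin (j + 1))) (e : Fin (j + 1) → placesOver F p), c j (e ∘ σ) = c j e)
variable (X : PilotData F)

/-- **The per-summand Step (v) bound over the real packet, for `p`-local Dupuy–Hilado data**: degree `j = i+1`,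
theta scalars `t_{Θ,j,v}` with `ord_v = P_{Θ,j}(v)`, a region `B` with `O_𝕃(−P_Θ)_{v⃗} ⊆ B_{v⃗}` and the SHARP
(Ind3) reading on the `S_{j+1}`-orbit of `v⃗`; then the local hull is admissible and
`log μ̄(hull) ≤ log μ̄(O_𝕃(−P_Θ)_{v⃗}) + {θ(v_j) − θ(v_{i₀})} + {d_I + 1}·log(p) + Σ_{i∈I*}{3 + log(e_i)}`.
[cite: Mochizuki2012, IUTchIV Thm 1.10 proof Step (v) p.27–28] [cite: DupuyHilado2025, §3.9, §4.11] -/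
theorem realPrimePacketWith_componentBound (i : Fin X.lstar) (e : Fin ((i : ℕ) + 1 + 1) → placesOver F p)
    (h12 : Prop12ii p (fun a => 𝔽.k (e a)))
    (t : Fin X.lstar → (v : placesOver F p) → (𝔽.k v)ˣ)
    (ht : ∀ v : placesOver F p, 𝔽.ordv (t i v) = X.thetaPilot i v.1)
    (B : (realPrimePacketWith p 𝔽 c hc0 hcσ).Region)
    (hB : (realPrimePacketWith p 𝔽 c hc0 hcσ).regionOf t ((i : ℕ) + 1) e ⊆ B _ e)
    (hsharp : ∀ σ : Equiv.Perm (Fin ((i : ℕ) + 1 + 1)),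
      B _ (e ∘ σ) ⊆ (realPrimePacketWith p 𝔽 c hc0 hcσ).regionOf t ((i : ℕ) + 1) (e ∘ σ))
    (Istar : Finset (Fin ((i : ℕ) + 1 + 1)))
    (htame : ∀ a, a ∉ Istar → absRamificationIdx p (𝔽.k (e a)) ≤ p - 2)
    (i₀ : Fin ((i : ℕ) + 1 + 1))
    (hmin : ∀ a, X.thetaPilot i (e i₀).1 * logNorm F (e i₀).1 / localDegree F (e i₀).1 ≤
      X.thetaPilot i (e a).1 * logNorm F (e a).1 / localDegree F (e a).1) :
    (realPrimePacketWith p 𝔽 c hc0 hcσ).adm ((realPrimePacketWith p 𝔽 c hc0 hcσ).localHull B _ e) ∧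
      (realPrimePacketWith p 𝔽 c hc0 hcσ).logμ ((realPrimePacketWith p 𝔽 c hc0 hcσ).localHull B _ e) ≤
        (realPrimePacketWith p 𝔽 c hc0 hcσ).logμ ((realPrimePacketWith p 𝔽 c hc0 hcσ).regionOf t ((i : ℕ) + 1) e)
          + ((X.thetaPilot i (e (Fin.last _)).1 * logNorm F (e (Fin.last _)).1 / localDegree F (e (Fin.last _)).1
              - X.thetaPilot i (e i₀).1 * logNorm F (e i₀).1 / localDegree F (e i₀).1)
            + (dSum p (fun a => 𝔽.k (e a)) + 1) * Real.log p
            + ∑ a ∈ Istar, (3 + Real.log (absRamificationIdx p (𝔽.k (e a))))) := by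
  have hj : 1 ≤ (i : ℕ) + 1 := by omega
  -- the bare regions are the twists through the last slot
  have hreg : ∀ e' : Fin ((i : ℕ) + 1 + 1) → placesOver F p,
      (realPrimePacketWith p 𝔽 c hc0 hcσ).regionOf t ((i : ℕ) + 1) e' =
        (realPrimePacketWith p 𝔽 c hc0 hcσ).peel (t i (e' (Fin.last _))) '' (realPrimePacketWith p 𝔽 c hc0 hcσ).O _ e' :=
    fun e' => PrimePacket.regionOf_succ_eq (realPrimePacketWith p 𝔽 c hc0 hcσ) t i e'
  -- the log-norms of the theta scalars
  have hlog : ∀ a, Real.log ‖(t i (e a) : 𝔽.k (e a))‖ =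
      -(X.thetaPilot i (e a).1 * logNorm F (e a).1 / localDegree F (e a).1) :=
    fun a => log_norm_of_ordv_eq 𝔽 (t i (e a)) (ht (e a))
  have hmax : ∀ a, ‖(t i (e a) : 𝔽.k (e a))‖ ≤ ‖(t i (e i₀) : 𝔽.k (e i₀))‖ := by
    intro a
    rw [← Real.log_le_log_iff (norm_pos_iff.mpr (t i (e a)).ne_zero) (norm_pos_iff.mpr (t i (e i₀)).ne_zero),
      hlog, hlog]
    exact neg_le_neg (hmin a)
  have hB' : (realPrimePacketWith p 𝔽 c hc0 hcσ).peel (t i (e (Fin.last _))) '' (realPrimePacketWith p 𝔽 c hc0 hcσ).O _ e ⊆ B _ e := by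
    rw [← hreg]; exact hB
  have hsharp' : ∀ σ : Equiv.Perm (Fin ((i : ℕ) + 1 + 1)),
      B _ (e ∘ σ) ⊆ (realPrimePacketWith p 𝔽 c hc0 hcσ).peel (t i (e (σ (Fin.last _)))) '' (realPrimePacketWith p 𝔽 c hc0 hcσ).O _ (e ∘ σ) := by
    intro σ
    have := hsharp σ
    rw [hreg] at this
    exact this
  have hv := realPrimePacketWith_stepV p 𝔽 c hc0 hcσ hj e h12 (t i) B hsharp' hB' Istar htame i₀ hmax
  refine ⟨hv.1, ?_⟩
  have h2 := hv.2
  rw [hlog i₀, hlog (Fin.last _)] at h2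
  rw [hreg e]
  show packetLogμ p (fun a => 𝔽.k (e a)) (packetHull p (fun a => 𝔽.k (e a))
      (⋃ (g : (realPrimePacketWith p 𝔽 c hc0 hcσ).G₂ _ e) (σ : Equiv.Perm (Fin ((i : ℕ) + 1 + 1))),
        g • ((realPrimePacketWith p 𝔽 c hc0 hcσ).perm σ e '' B _ (e ∘ σ)))) ≤
    packetLogμ p (fun a => 𝔽.k (e a))
        ((realPrimePacketWith p 𝔽 c hc0 hcσ).peel (t i (e (Fin.last _))) '' (realPrimePacketWith p 𝔽 c hc0 hcσ).O _ e) + _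
  linarith


end RealWith

namespace PrimePacket

variable {p : ℕ} [Fact p.Prime] (𝔽 : LocalFields F p)
variable (c : (j : ℕ) → (Fin (j + 1) → placesOver F p) → ℚ_[p]) (hc0 : ∀ j e, c j e ≠ 0)
  (hcσ : ∀ (j : ℕ) (σ : Equiv.Perm (Fin (j + 1))) (e : Fin (j + 1) → placesOver F p), c j (e ∘ σ) = c j e)
variable (X : PilotData F)

/-- The same bound for ANY prime packet EQUAL to the real one (the `p`-part of a model assembled by
`IndPacketModel.ofPrimesLine`). [cite: DupuyHilado2025, Def. 3.6.3] -/
theorem componentBound_of_eq_with (Q : PrimePacket F p) (hQ : Q = realPrimePacketWith p 𝔽 c hc0 hcσ)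
    (i : Fin X.lstar) (e : Fin ((i : ℕ) + 1 + 1) → placesOver F p)
    (h12 : Prop12ii p (fun a => 𝔽.k (e a)))
    (t : Fin X.lstar → (v : placesOver F p) → Q.Λ v)
    (ht : ∀ v : placesOver F p, Q.ordv (t i v) = X.thetaPilot i v.1)
    (B : Q.Region) (hB : Q.regionOf t ((i : ℕ) + 1) e ⊆ B _ e)
    (hsharp : ∀ σ : Equiv.Perm (Fin ((i : ℕ) + 1 + 1)), B _ (e ∘ σ) ⊆ Q.regionOf t ((i : ℕ) + 1) (e ∘ σ))
    (Istar : Finset (Fin ((i : ℕ) + 1 + 1)))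
    (htame : ∀ a, a ∉ Istar → absRamificationIdx p (𝔽.k (e a)) ≤ p - 2)
    (i₀ : Fin ((i : ℕ) + 1 + 1))
    (hmin : ∀ a, X.thetaPilot i (e i₀).1 * logNorm F (e i₀).1 / localDegree F (e i₀).1 ≤
      X.thetaPilot i (e a).1 * logNorm F (e a).1 / localDegree F (e a).1) :
    Q.adm (Q.localHull B _ e) ∧
      Q.logμ (Q.localHull B _ e) ≤ Q.logμ (Q.regionOf t ((i : ℕ) + 1) e)
        + ((X.thetaPilot i (e (Fin.last _)).1 * logNorm F (e (Fin.last _)).1 / localDegree F (e (Fin.last _)).1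
            - X.thetaPilot i (e i₀).1 * logNorm F (e i₀).1 / localDegree F (e i₀).1)
          + (dSum p (fun a => 𝔽.k (e a)) + 1) * Real.log p
          + ∑ a ∈ Istar, (3 + Real.log (absRamificationIdx p (𝔽.k (e a))))) := by
  subst hQ
  exact realPrimePacketWith_componentBound 𝔽 c hc0 hcσ X i e h12 t ht B hB hsharp Istar htame i₀ hmin


omit [Fact p.Prime] in
/-- Transport of the sharpness property along an equality of packets. [cite: DupuyHilado2025, Def. 3.6.3] -/
theorem DHDatum.transport_bare3_subset_regionOf {Q Q' : PrimePacket F p} (h : Q = Q') (dd : Q'.DHDatum X)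
    (H : ∀ j e, dd.bare3 j e ⊆ Q'.regionOf dd.tΘ j e) (j : ℕ) (e : Fin (j + 1) → placesOver F p) :
    (PrimePacket.DHDatum.transport h dd).bare3 j e ⊆ Q.regionOf (PrimePacket.DHDatum.transport h dd).tΘ j e := by
  subst h
  exact H j e

end PrimePacket

namespace IndPacketModel

/-- Pointwise form of `region_eq_regionOf`: the `(p,j,v⃗)`-component of `O_𝕃(−div t)` is the `p`-local
`regionOf` of the `p`-part. [cite: DupuyHilado2025, §3.9] -/
theorem region_eq_regionOf_apply (M : IndPacketModel F) {lstar : ℕ} (t : M.LgpIdele lstar) (p j : ℕ)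
    (e : Fin (j + 1) → placesOver F p) :
    M.region t p j e = (M.primePart p).regionOf (fun i v => t i p v) j e := rfl

end IndPacketModel

end Literature.IUT.LogVolume

namespace Summit.ABC.IUTFork

open Literature.IUT.LogVolume NumberField IsDedekindDomain
open scoped Pointwise

variable {F : Type} [Field F] [NumberField F]

namespace DHData

/-- **The idele-built datum is SHARP**: at every prime its (Ind3)-region IS the bare region `O_𝕃(−P_Θ)`.
[cite: Mochizuki2012, IUTchIV Prop. 1.2 (ii) p. 10] -/
theorem ofIdelesM_bare3_subset_region (X : PilotData F) (𝔽 : LocalFieldFamily F)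
    (tΘ : ∀ (p : ℕ) (hp : p.Prime), Fin X.lstar → (v : placesOver F p) → (@LocalFields.k F _ _ p ⟨hp⟩ (𝔽 p hp) v)ˣ)
    (tΘ_ord : ∀ p hp (i : Fin X.lstar) (v : placesOver F p),
      @LocalFields.ordv F _ _ p ⟨hp⟩ (𝔽 p hp) v (tΘ p hp i v) = X.thetaPilot i v.1)
    (tq : ∀ (p : ℕ) (hp : p.Prime), Fin X.lstar → (v : placesOver F p) → (@LocalFields.k F _ _ p ⟨hp⟩ (𝔽 p hp) v)ˣ)
    (tq_ord : ∀ p hp (i : Fin X.lstar) (v : placesOver F p),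
      @LocalFields.ordv F _ _ p ⟨hp⟩ (𝔽 p hp) v (tq p hp i v) = X.qPilot v.1)
    (T : Finset ℕ) (T_prime : ∀ p ∈ T, p.Prime) (S_sub : ∀ v ∈ X.S, residueChar F v ∈ T)
    {p : ℕ} (hp : p.Prime) (j : ℕ) (e : Fin (j + 1) → placesOver F p) :
    (ofIdelesM X 𝔽 tΘ tΘ_ord tq tq_ord T T_prime S_sub).ind3.bare3 p j e ⊆
      (ofIdelesM X 𝔽 tΘ tΘ_ord tq tq_ord T T_prime S_sub).M.region
        (ofIdelesM X 𝔽 tΘ tΘ_ord tq tq_ord T T_prime S_sub).tΘ p j e := by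
  classical
  rw [IndPacketModel.region_eq_regionOf_apply]
  unfold ofIdelesM DHData.ofPrimesLine DHData.ofPrimewise
  simp only [dif_pos hp]
  exact PrimePacket.DHDatum.transport_bare3_subset_regionOf X _ _ (fun _ _ => subset_rfl) j e

/-- **D9′ per summand for the idele-built datum (Mochizuki shell): NO hypothesis beyond the ideles** — degree
`j` (`1 ≤ j ≤ ℓ⋇`), collection `v⃗`, tameness set `I*`, `i₀` of least `θ`; [IUTchIV] Prop. 1.2 (ii) by
`prop12ii_holds`, sharpness by `ofIdelesM_bare3_subset_region`.
[cite: Mochizuki2012, IUTchIV Thm 1.10 proof Step (v) p.27–28] [claim: Mochizuki2012, status: disputed] -/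
theorem componentBound_ofIdelesM (X : PilotData F) (𝔽 : LocalFieldFamily F)
    (tΘ : ∀ (p : ℕ) (hp : p.Prime), Fin X.lstar → (v : placesOver F p) → (@LocalFields.k F _ _ p ⟨hp⟩ (𝔽 p hp) v)ˣ)
    (tΘ_ord : ∀ p hp (i : Fin X.lstar) (v : placesOver F p),
      @LocalFields.ordv F _ _ p ⟨hp⟩ (𝔽 p hp) v (tΘ p hp i v) = X.thetaPilot i v.1)
    (tq : ∀ (p : ℕ) (hp : p.Prime), Fin X.lstar → (v : placesOver F p) → (@LocalFields.k F _ _ p ⟨hp⟩ (𝔽 p hp) v)ˣ)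
    (tq_ord : ∀ p hp (i : Fin X.lstar) (v : placesOver F p),
      @LocalFields.ordv F _ _ p ⟨hp⟩ (𝔽 p hp) v (tq p hp i v) = X.qPilot v.1)
    (T : Finset ℕ) (T_prime : ∀ p ∈ T, p.Prime) (S_sub : ∀ v ∈ X.S, residueChar F v ∈ T)
    {p : ℕ} [hp : Fact p.Prime] {j : ℕ} (hj : 1 ≤ j) (hjl : j ≤ X.lstar) (e : Fin (j + 1) → placesOver F p)
    (Istar : Finset (Fin (j + 1)))
    (htame : ∀ a, a ∉ Istar → absRamificationIdx p ((𝔽 p hp.out).k (e a)) ≤ p - 2)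
    (i₀ : Fin (j + 1))
    (hmin : ∀ a, X.thetaPilot ⟨j - 1, by omega⟩ (e i₀).1 * logNorm F (e i₀).1 / localDegree F (e i₀).1 ≤
      X.thetaPilot ⟨j - 1, by omega⟩ (e a).1 * logNorm F (e a).1 / localDegree F (e a).1) :
    (ofIdelesM X 𝔽 tΘ tΘ_ord tq tq_ord T T_prime S_sub).M.logμ
        ((ofIdelesM X 𝔽 tΘ tΘ_ord tq tq_ord T T_prime S_sub).M.hullUTheta (ofIdelesM X 𝔽 tΘ tΘ_ord tq tq_ord T T_prime S_sub).ind3 p j e) ≤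
      (ofIdelesM X 𝔽 tΘ tΘ_ord tq tq_ord T T_prime S_sub).M.logμ
          ((ofIdelesM X 𝔽 tΘ tΘ_ord tq tq_ord T T_prime S_sub).M.region (ofIdelesM X 𝔽 tΘ tΘ_ord tq tq_ord T T_prime S_sub).tΘ p j e)
        + ((X.thetaPilot ⟨j - 1, by omega⟩ (e (Fin.last j)).1 * logNorm F (e (Fin.last j)).1
              / localDegree F (e (Fin.last j)).1
            - X.thetaPilot ⟨j - 1, by omega⟩ (e i₀).1 * logNorm F (e i₀).1 / localDegree F (e i₀).1)
          + (dSum p (fun a => (𝔽 p hp.out).k (e a)) + 1) * Real.log p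
          + ∑ a ∈ Istar, (3 + Real.log (absRamificationIdx p ((𝔽 p hp.out).k (e a))))) := by
  obtain ⟨i, rfl⟩ : ∃ i : ℕ, j = i + 1 := ⟨j - 1, by omega⟩
  have hi : i < X.lstar := by omega
  set D := ofIdelesM X 𝔽 tΘ tΘ_ord tq tq_ord T T_prime S_sub with hD
  rw [D.M.hullUTheta_eq_localHull D.ind3 p _ e]
  have hQ : D.M.primePart p = realPrimePacketWith p (𝔽 p hp.out) (mScale p (𝔽 p hp.out))
      (mScale_ne_zero p (𝔽 p hp.out)) (mScale_perm p (𝔽 p hp.out)) :=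
    primePart_tensorPacketModelM 𝔽 hp.out
  exact (PrimePacket.componentBound_of_eq_with (𝔽 p hp.out) _ _ _ X (D.M.primePart p) hQ ⟨i, hi⟩ e
    (prop12ii_holds p _) (fun i' v => D.tΘ i' p v) (fun v => D.tΘ_ord ⟨i, hi⟩ p v) (D.M.regionAt D.ind3.bare3 p)
    (D.ind3.region_subset p _ e)
    (fun σ => ofIdelesM_bare3_subset_region X 𝔽 tΘ tΘ_ord tq tq_ord T T_prime S_sub hp.out _ (e ∘ σ))
    Istar htame i₀ hmin).2

/-- **`EstimateDH` with an EXPLICIT constant for the idele-built datum — nothing assumed beyond the ideles**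
(`δ(p,j,v⃗) = {θ(v_j) − min_a θ(v_a)} + {d_I + 1}·log(p) + Σ_{a : e_a > p−2}{3 + log(e_a)}`, as in
`estimateDH_ofTensor_of_sharp`; Prop. 1.2 (ii) and the sharp (Ind3) reading are THEOREMS here).
[cite: Mochizuki2012, IUTchIV Thm 1.10 proof Steps (iv)–(viii) pp.26–30] [claim: Mochizuki2012, status: disputed] -/
theorem estimateDH_ofIdelesM (X : PilotData F) (𝔽 : LocalFieldFamily F)
    (tΘ : ∀ (p : ℕ) (hp : p.Prime), Fin X.lstar → (v : placesOver F p) → (@LocalFields.k F _ _ p ⟨hp⟩ (𝔽 p hp) v)ˣ)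
    (tΘ_ord : ∀ p hp (i : Fin X.lstar) (v : placesOver F p),
      @LocalFields.ordv F _ _ p ⟨hp⟩ (𝔽 p hp) v (tΘ p hp i v) = X.thetaPilot i v.1)
    (tq : ∀ (p : ℕ) (hp : p.Prime), Fin X.lstar → (v : placesOver F p) → (@LocalFields.k F _ _ p ⟨hp⟩ (𝔽 p hp) v)ˣ)
    (tq_ord : ∀ p hp (i : Fin X.lstar) (v : placesOver F p),
      @LocalFields.ordv F _ _ p ⟨hp⟩ (𝔽 p hp) v (tq p hp i v) = X.qPilot v.1)
    (T : Finset ℕ) (T_prime : ∀ p ∈ T, p.Prime) (S_sub : ∀ v ∈ X.S, residueChar F v ∈ T) :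
    (ofIdelesM X 𝔽 tΘ tΘ_ord tq tq_ord T T_prime S_sub).EstimateDH
      (∑ p ∈ T, (1 / (X.lstar : ℝ)) * ∑ i : Fin X.lstar, ∑ e : Fin ((i : ℕ) + 1 + 1) → placesOver F p,
        (fun (p j : ℕ) (e : Fin (j + 1) → placesOver F p) =>
          if h : p.Prime ∧ 0 < j ∧ j - 1 < X.lstar then
            haveI : Fact p.Prime := ⟨h.1⟩
            (X.thetaPilot ⟨j - 1, h.2.2⟩ (e (Fin.last j)).1 * logNorm F (e (Fin.last j)).1
                / localDegree F (e (Fin.last j)).1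
              - Finset.univ.inf' ⟨0, Finset.mem_univ _⟩ (fun a =>
                  X.thetaPilot ⟨j - 1, h.2.2⟩ (e a).1 * logNorm F (e a).1 / localDegree F (e a).1))
            + (dSum p (fun a => (𝔽 p h.1).k (e a)) + 1) * Real.log p
            + ∑ a ∈ Finset.univ.filter (fun a => p - 2 < absRamificationIdx p ((𝔽 p h.1).k (e a))),
                (3 + Real.log (absRamificationIdx p ((𝔽 p h.1).k (e a))))
          else 0) p ((i : ℕ) + 1) e * ∏ k, weight F (e k).1) := by
  refine (ofIdelesM X 𝔽 tΘ tΘ_ord tq tq_ord T T_prime S_sub).estimateDH_of_componentBounds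
    (fun (p j : ℕ) (e : Fin (j + 1) → placesOver F p) =>
      if h : p.Prime ∧ 0 < j ∧ j - 1 < X.lstar then
        haveI : Fact p.Prime := ⟨h.1⟩
        (X.thetaPilot ⟨j - 1, h.2.2⟩ (e (Fin.last j)).1 * logNorm F (e (Fin.last j)).1
            / localDegree F (e (Fin.last j)).1
          - Finset.univ.inf' ⟨0, Finset.mem_univ _⟩ (fun a =>
              X.thetaPilot ⟨j - 1, h.2.2⟩ (e a).1 * logNorm F (e a).1 / localDegree F (e a).1))
        + (dSum p (fun a => (𝔽 p h.1).k (e a)) + 1) * Real.log p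
        + ∑ a ∈ Finset.univ.filter (fun a => p - 2 < absRamificationIdx p ((𝔽 p h.1).k (e a))),
            (3 + Real.log (absRamificationIdx p ((𝔽 p h.1).k (e a))))
      else 0) ?_
  intro p hpT j hj1 hj2 e
  haveI hp : Fact p.Prime := ⟨T_prime p hpT⟩
  have hc : p.Prime ∧ 0 < j ∧ j - 1 < X.lstar := ⟨T_prime p hpT, hj1, by
    change j ≤ X.lstar at hj2
    omega⟩
  rw [dif_pos hc]
  -- a slot of least `θ`
  obtain ⟨i₀, -, hi₀⟩ := Finset.exists_min_image Finset.univ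
    (fun a : Fin (j + 1) => X.thetaPilot ⟨j - 1, hc.2.2⟩ (e a).1 * logNorm F (e a).1 / localDegree F (e a).1)
    ⟨0, Finset.mem_univ _⟩
  have hcb := componentBound_ofIdelesM X 𝔽 tΘ tΘ_ord tq tq_ord T T_prime S_sub hj1 hj2 e
    (Finset.univ.filter (fun a => p - 2 < absRamificationIdx p ((𝔽 p hp.out).k (e a))))
    (fun a ha => by
      rw [Finset.mem_filter, not_and] at ha
      exact Nat.le_of_not_lt (ha (Finset.mem_univ a)))
    i₀ (fun a => hi₀ a (Finset.mem_univ a))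
  have hinf : Finset.univ.inf' ⟨0, Finset.mem_univ _⟩ (fun a : Fin (j + 1) =>
      X.thetaPilot ⟨j - 1, hc.2.2⟩ (e a).1 * logNorm F (e a).1 / localDegree F (e a).1) ≤
      X.thetaPilot ⟨j - 1, hc.2.2⟩ (e i₀).1 * logNorm F (e i₀).1 / localDegree F (e i₀).1 :=
    Finset.inf'_le _ (Finset.mem_univ i₀)
  linarith

/-- **The squeeze for the idele-built datum**: Dupuy–Hilado's (1.1) in Mochizuki's normalisation (`Cor312DH`,
HYPOTHESIS) gives `deĝ̲_lgp(P_Θ) − deĝ̲(P_q) ≤ δΣ` — nothing else assumed. [claim: Mochizuki2012, status: disputed] -/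
theorem gap_le_ofIdelesM (X : PilotData F) (𝔽 : LocalFieldFamily F)
    (tΘ : ∀ (p : ℕ) (hp : p.Prime), Fin X.lstar → (v : placesOver F p) → (@LocalFields.k F _ _ p ⟨hp⟩ (𝔽 p hp) v)ˣ)
    (tΘ_ord : ∀ p hp (i : Fin X.lstar) (v : placesOver F p),
      @LocalFields.ordv F _ _ p ⟨hp⟩ (𝔽 p hp) v (tΘ p hp i v) = X.thetaPilot i v.1)
    (tq : ∀ (p : ℕ) (hp : p.Prime), Fin X.lstar → (v : placesOver F p) → (@LocalFields.k F _ _ p ⟨hp⟩ (𝔽 p hp) v)ˣ)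
    (tq_ord : ∀ p hp (i : Fin X.lstar) (v : placesOver F p),
      @LocalFields.ordv F _ _ p ⟨hp⟩ (𝔽 p hp) v (tq p hp i v) = X.qPilot v.1)
    (T : Finset ℕ) (T_prime : ∀ p ∈ T, p.Prime) (S_sub : ∀ v ∈ X.S, residueChar F v ∈ T)
    (h11 : (ofIdelesM X 𝔽 tΘ tΘ_ord tq tq_ord T T_prime S_sub).Cor312DH) :
    LgpDivisor.ndegLgp X.thetaPilot - FinDivisor.ndeg F X.qPilot ≤
      (∑ p ∈ T, (1 / (X.lstar : ℝ)) * ∑ i : Fin X.lstar, ∑ e : Fin ((i : ℕ) + 1 + 1) → placesOver F p,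
        (fun (p j : ℕ) (e : Fin (j + 1) → placesOver F p) =>
          if h : p.Prime ∧ 0 < j ∧ j - 1 < X.lstar then
            haveI : Fact p.Prime := ⟨h.1⟩
            (X.thetaPilot ⟨j - 1, h.2.2⟩ (e (Fin.last j)).1 * logNorm F (e (Fin.last j)).1
                / localDegree F (e (Fin.last j)).1
              - Finset.univ.inf' ⟨0, Finset.mem_univ _⟩ (fun a =>
                  X.thetaPilot ⟨j - 1, h.2.2⟩ (e a).1 * logNorm F (e a).1 / localDegree F (e a).1))
            + (dSum p (fun a => (𝔽 p h.1).k (e a)) + 1) * Real.log p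
            + ∑ a ∈ Finset.univ.filter (fun a => p - 2 < absRamificationIdx p ((𝔽 p h.1).k (e a))),
                (3 + Real.log (absRamificationIdx p ((𝔽 p h.1).k (e a))))
          else 0) p ((i : ℕ) + 1) e * ∏ k, weight F (e k).1) :=
  (ofIdelesM X 𝔽 tΘ tΘ_ord tq tq_ord T T_prime S_sub).gap_le_of_cor312DH_of_estimateDH h11
    (estimateDH_ofIdelesM X 𝔽 tΘ tΘ_ord tq tq_ord T T_prime S_sub)

end DHData

end Summit.ABC.IUTFork

end
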